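import Mathlib

/-!
# SoloBlind E66 — candidate depth laws at two-Eisenstein-prime levels

At a squarefree level `N` with exactly two Eisenstein primes `p₁, p₂` (so the Eisenstein
exponent is `m = 2`), the two Yoo-type bases `N/p₂`, `N/p₁` produce valuations
`v₁ = v_λ(η_{p₂})`, `v₂ = v_λ(η_{p₁})` (each `≥ 1`, value `1` meaning "generator").
Three candidate laws for the depth `μ(N) ∈ {0,1,2}` fit all ten computed levels:
`pairCount` (number of non-generators), `pairSum` (sum of excesses, capped at `m = 2`) and
`pairMax` (largest excess, capped at 2).  The lemmas below record exactly where they differ,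
i.e. which levels discriminate them: both valuations `≥ 2` separates `pairMax` from the
other two; one valuation `≥ 3` with the other `= 1` separates `pairCount` from the other two.
Pure arithmetic (`omega`); no modular-form content is formalised here.
-/

namespace Summit.Langlands.Langlands.Theorems

/-- Number of non-generator bases: `#{i : vᵢ ≥ 2}`. -/
def pairCount (v₁ v₂ : ℕ) : ℕ := (if 2 ≤ v₁ then 1 else 0) + (if 2 ≤ v₂ then 1 else 0)

/-- Sum of the excesses `vᵢ - 1`, capped at the Eisenstein exponent `2`. -/
def pairSum (v₁ v₂ : ℕ) : ℕ := min 2 ((v₁ - 1) + (v₂ - 1))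

/-- Largest excess `vᵢ - 1`, capped at `2`. -/
def pairMax (v₁ v₂ : ℕ) : ℕ := min 2 (max (v₁ - 1) (v₂ - 1))

/-- All three laws vanish exactly when both valuations are `≤ 1` (both generators). -/
theorem pairCount_eq_zero_iff (v₁ v₂ : ℕ) : pairCount v₁ v₂ = 0 ↔ v₁ ≤ 1 ∧ v₂ ≤ 1 := by
  unfold pairCount
  constructor
  · intro h
    split_ifs at h <;> omega
  · rintro ⟨h1, h2⟩
    rw [if_neg (by omega), if_neg (by omega)]

/-- `pairSum` vanishes iff both valuations are `≤ 1`. -/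
theorem pairSum_eq_zero_iff (v₁ v₂ : ℕ) : pairSum v₁ v₂ = 0 ↔ v₁ ≤ 1 ∧ v₂ ≤ 1 := by
  unfold pairSum; omega

/-- `pairMax` vanishes iff both valuations are `≤ 1`. -/
theorem pairMax_eq_zero_iff (v₁ v₂ : ℕ) : pairMax v₁ v₂ = 0 ↔ v₁ ≤ 1 ∧ v₂ ≤ 1 := by
  unfold pairMax; omega

/-- The three laws are all `≤ 2`. -/
theorem pair_laws_le_two (v₁ v₂ : ℕ) :
    pairCount v₁ v₂ ≤ 2 ∧ pairSum v₁ v₂ ≤ 2 ∧ pairMax v₁ v₂ ≤ 2 := by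
  unfold pairCount pairSum pairMax; refine ⟨?_, ?_, ?_⟩
  · split_ifs <;> omega
  · omega
  · omega

/-- The max law never exceeds the sum law. -/
theorem pairMax_le_pairSum (v₁ v₂ : ℕ) : pairMax v₁ v₂ ≤ pairSum v₁ v₂ := by
  unfold pairMax pairSum; omega

/-- DISCRIMINATOR 1: with both valuations `≥ 2` (e.g. `N = 13206`: `(2,2)`), `pairCount = 2`
while `pairMax = 1` when both equal `2`. -/
theorem discriminator_both_nongen (v₁ v₂ : ℕ) (h₁ : v₁ = 2) (h₂ : v₂ = 2) :
    pairCount v₁ v₂ = 2 ∧ pairSum v₁ v₂ = 2 ∧ pairMax v₁ v₂ = 1 := by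
  subst h₁; subst h₂; decide

/-- DISCRIMINATOR 2: one valuation `≥ 3`, the other `= 1` (e.g. `N = 17886` if the partner base
is a generator: `(3,1)`): `pairCount = 1` while `pairSum = pairMax = 2`. -/
theorem discriminator_deep_vs_gen (v₁ v₂ : ℕ) (h₁ : 3 ≤ v₁) (h₂ : v₂ = 1) :
    pairCount v₁ v₂ = 1 ∧ pairSum v₁ v₂ = 2 ∧ pairMax v₁ v₂ = 2 := by
  subst h₂; unfold pairCount pairSum pairMax
  refine ⟨?_, ?_, ?_⟩
  · rw [if_pos (by omega), if_neg (by omega)]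
  · omega
  · omega

/-- Where all three laws AGREE: if `v₁ ≤ 2`, `v₂ ≤ 2` and not both equal `2`, the three coincide
(this covers nine of the ten computed levels; `4774 = (2,3)` is the next lemma). -/
theorem pair_laws_agree_small (v₁ v₂ : ℕ) (h₁ : v₁ ≤ 2) (h₂ : v₂ ≤ 2) (h : ¬ (v₁ = 2 ∧ v₂ = 2)) :
    pairCount v₁ v₂ = pairSum v₁ v₂ ∧ pairSum v₁ v₂ = pairMax v₁ v₂ := by
  unfold pairCount pairSum pairMax
  constructor
  · split_ifs <;> omega
  · omega

/-- The level `4774 = 2·7·11·31` has valuations `(2,3)` and `μ = 2`: count and sum give `2`,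
max gives `2` as well — it does not discriminate. -/
theorem level_4774_profile : pairCount 2 3 = 2 ∧ pairSum 2 3 = 2 ∧ pairMax 2 3 = 2 := by decide

/-- The level `7626 = 2·3·31·41` has valuations `(1,2)` and `μ = 1`: all three laws give `1`. -/
theorem level_7626_profile : pairCount 1 2 = 1 ∧ pairSum 1 2 = 1 ∧ pairMax 1 2 = 1 := by decide

end Summit.Langlands.Langlands.Theorems
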